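import Literature.Geometry.Lorentzian.KIDChartProlongation
import Literature.Geometry.Lorentzian.CoordKIDEquations
import HarnessLib

/-!
# Killing initial data are determined by their one-jet at a point (chart level)

Topic `Literature/Geometry/Lorentzian`. In the coordinate tensor calculus `MetricCoord` (metric
components `G` on an open set `V` of a finite-dimensional space, `IsMetricOn G V`, any signature,
dimension `≠ 1`) let `K` be a smooth symmetric field, let the vacuum constraints `H = 0`, `M = 0`
hold on `V`, and let `(N, X)` be a smooth **KID**: a solution of the adjoint linearised constraint
equations `DH*_γ N + DM*ˢ_γ X = 0`, `DH*_κ N + DM*ˢ_κ X = 0` (`CoordConstraintAdjoint.lean`). Then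
(`CoordKIDEquations.lean`) `𝓛_X G = −4N K` and
`Hess N = N (Ric + tr K · K − 2 K∘♯K) − ½ 𝓛_X K` (Moncrief 1975, §IV; Beig–Chruściel 1997,
(1.3)–(1.4)), a system which **prolongs to a closed first-order linear system for the one-jet
`(N, DN, X, DX)`** (Beig–Chruściel 1997, §2): the second equation expresses `D²N` through
`(N, DN, X, DX)` (`IsMetricOn.fderiv_fderiv_lapse_apply`), and the braid identity for the first
(`KIDChartProlongation.lean`) expresses `D²X` through `(X, DX)` and `D(N K)`. Hence

* `IsMetricOn.exists_norm_fderiv_fderiv_lapse_le`, `IsMetricOn.exists_norm_fderiv_fderiv_shift_le`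
  — near every point of `V`, `‖D²N‖, ‖D²X‖ ≤ C (|N| + ‖DN‖ + ‖X‖ + ‖DX‖)`;
* **`IsMetricOn.kid_eq_zero_of_oneJet_eq_zero`** — on a preconnected `V`, a smooth KID whose one-jet
  `(N, DN, X, DX)` vanishes at one point of `V` vanishes on `V` (Grönwall propagation,
  `KIDJetRigidity.eqOn_zero_of_isPreconnected_of_norm_fderiv_le`).

This is the initial-data form of the classical fact that a Killing field is determined by its
one-jet at a point (Moncrief 1975, §III: KIDs are the Cauchy data of the Killing fields of the
vacuum development; in the tree the space–time statement is
`IsKillingField.eq_zero_of_oneJet_eq_zero`), proved here directly on the data, without any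
development. Everything is PROVED; no definition and no statement of `Prop` type is introduced.

## References

* V. Moncrief, J. Math. Phys. 16 (1975) 493–498, §§III–IV. [Moncrief1975]
* R. Beig, P. T. Chruściel, *Killing initial data*, Class. Quantum Grav. 14 (1997) A83–A92, §2.
  [BeigChrusciel1997]
* B. O'Neill, *Semi-Riemannian geometry*, 1983, Ch. 9, Lemma 9.28. [ONeill1983]
-/

noncomputable section

set_option maxSynthPendingDepth 3

open Set Filter Module Function Metric

open scoped ContDiff Topology

namespace Literature.Geometry.Lorentzian

namespace MetricCoord

variable {E : Type*} [NormedAddCommGroup E] [NormedSpace ℝ E] [FiniteDimensional ℝ E]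
  {ι : Type*} [Fintype ι] (b : Basis ι ℝ E)
  {G K : E → E →L[ℝ] E →L[ℝ] ℝ} {V : Set E} {x : E} {N : E → ℝ} {X : E → E}

/-! ### The second derivatives of the lapse through the one-jet -/

/-- **`D²N` through the one-jet of the KID.** At a point `x ∈ V` where the KID rows and the vacuum
constraints hold (`K` symmetric on `V`, dimension `≠ 1`),
`D²N_x(Y,Z) = N x · (Ric + tr_G K · K − 2 K∘♯K)_x(Y,Z) − ½ (DK_x(X x)(Y,Z) + K_x(DX_x Y, Z) + K_x(Y, DX_x Z)) + DN_x(Γ_x(Y,Z))`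
(the second KID equation `IsMetricOn.kid₂_eq_zero`, `Hess N = D²N − DN ∘ Γ` and
`𝓛_X K = DK(X) + K(DX·,·) + K(·,DX·)`). [cite: Moncrief1975, §IV] -/
theorem IsMetricOn.fderiv_fderiv_lapse_apply (hG : IsMetricOn G V) (hx : x ∈ V)
    (hn : finrank ℝ E ≠ 1) (hKd : DifferentiableAt ℝ K x) (hKs : ∀ y ∈ V, ∀ v w, K y v w = K y w v)
    (hXd : DifferentiableAt ℝ X x)
    (hκ : adjHamK G K N x + adjMomKS G X x = 0) (hγ : adjHamG G K N x + adjMomGS G K X x = 0)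
    (hham : hamAt G K x = 0) (hmom : momFn b G K x (X x) = 0) (Y Z : E) :
    fderiv ℝ (fderiv ℝ N) x Y Z =
      N x * (ricAt G x + (mtrAt G x (K x)) • K x
          - (2 : ℝ) • (K x).comp ((sharpAt G x).comp (K x))) Y Z
        - 2⁻¹ * (fderiv ℝ K x (X x) Y Z + K x (fderiv ℝ X x Y) Z + K x Y (fderiv ℝ X x Z))
        + fderiv ℝ N x (chrAt G x Y Z) := by
  have h := hG.kid₂_eq_zero b hx hn hKd hKs hXd hκ hγ hham hmom
  have hYZ := congrArg (fun B : E →L[ℝ] E →L[ℝ] ℝ ↦ B Y Z) h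
  simp only [_root_.add_apply, _root_.sub_apply, _root_.smul_apply, smul_eq_mul, hessAt_apply,
    lieFormAt_apply, ContinuousLinearMap.comp_apply, _root_.zero_apply] at hYZ
  simp only [_root_.add_apply, _root_.sub_apply, _root_.smul_apply, smul_eq_mul,
    ContinuousLinearMap.comp_apply]
  linarith

/-! ### Local bounds -/

omit [NormedSpace ℝ E] [FiniteDimensional ℝ E] in
/-- A map continuous at `x₀` is bounded by `‖f x₀‖ + 1` near `x₀`. [folklore] -/
private theorem eventually_norm_le {F : Type*} [NormedAddCommGroup F] {f : E → F} {x₀ : E}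
    (hf : ContinuousAt f x₀) : ∀ᶠ x in 𝓝 x₀, ‖f x‖ ≤ ‖f x₀‖ + 1 := by
  have h := Metric.continuousAt_iff'.1 hf 1 one_pos
  filter_upwards [h] with x hx
  rw [dist_eq_norm] at hx
  have := norm_le_insert' (f x) (f x₀)
  linarith

set_option maxHeartbeats 400000 in
/-- **Prolongation bound for the lapse.** For a smooth KID `(N, X)` of smooth data `(G, K)` on `V`
satisfying the vacuum constraints (dimension `≠ 1`), near every point of `V`
`‖D²N_x‖ ≤ C (|N x| + ‖DN_x‖ + ‖X x‖ + ‖DX_x‖)` (from `IsMetricOn.fderiv_fderiv_lapse_apply`, the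
coefficients being continuous). Beig–Chruściel 1997, §2. [cite: BeigChrusciel1997, §2] -/
theorem IsMetricOn.exists_norm_fderiv_fderiv_lapse_le (hG : IsMetricOn G V) (hn : finrank ℝ E ≠ 1)
    (hK : ContDiffOn ℝ ∞ K V) (hKs : ∀ y ∈ V, ∀ v w, K y v w = K y w v)
    (hcv : ∀ y ∈ V, hamAt G K y = 0 ∧ ∀ Z : E, momFn b G K y Z = 0)
    (hX : ContDiffOn ℝ ∞ X V)
    (hkid : ∀ y ∈ V, adjHamG G K N y + adjMomGS G K X y = 0 ∧ adjHamK G K N y + adjMomKS G X y = 0)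
    {x₀ : E} (hx₀ : x₀ ∈ V) :
    ∃ C : ℝ, ∀ᶠ x in 𝓝 x₀, ‖fderiv ℝ (fderiv ℝ N) x‖ ≤
      C * (‖N x‖ + ‖fderiv ℝ N x‖ + ‖X x‖ + ‖fderiv ℝ X x‖) := by
  have hxs : V ∈ 𝓝 x₀ := hG.mem_nhds hx₀
  -- the coefficient fields and their continuity at `x₀`
  set P : E → E →L[ℝ] E →L[ℝ] ℝ := fun y ↦ ricAt G y + (mtrAt G y (K y)) • K y
      - (2 : ℝ) • (K y).comp ((sharpAt G y).comp (K y)) with hP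
  have hPs : ContDiffOn ℝ ∞ P V :=
    (hG.contDiffOn_ricAt.add ((hG.contDiffOn_mtrAt hK).smul hK)).sub
      ((hK.clm_comp (hG.contDiffOn_sharpAt.clm_comp hK)).const_smul (2 : ℝ))
  have hK1 : ContDiffOn ℝ ∞ (fderiv ℝ K) V := hK.fderiv_of_isOpen hG.isOpen (by simp)
  have hPc : ContinuousAt P x₀ := (hPs.continuousOn.continuousWithinAt hx₀).continuousAt hxs
  have hKc : ContinuousAt K x₀ := (hK.continuousOn.continuousWithinAt hx₀).continuousAt hxs
  have hK'c : ContinuousAt (fderiv ℝ K) x₀ :=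
    (hK1.continuousOn.continuousWithinAt hx₀).continuousAt hxs
  have hΓc : ContinuousAt (chrAt G) x₀ :=
    (hG.contDiffOn_chrAt.continuousOn.continuousWithinAt hx₀).continuousAt hxs
  set a : ℝ := ‖P x₀‖ + 1 with ha
  set k : ℝ := ‖K x₀‖ + 1 with hk
  set k' : ℝ := ‖fderiv ℝ K x₀‖ + 1 with hk'
  set c : ℝ := ‖chrAt G x₀‖ + 1 with hc
  refine ⟨a + k + k' + c, ?_⟩
  filter_upwards [eventually_norm_le hPc, eventually_norm_le hKc, eventually_norm_le hK'c,
    eventually_norm_le hΓc, hG.eventually_mem hx₀] with x hPx hKx hK'x hcx hx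
  have ha0 : 0 ≤ a := by positivity
  have hk0 : 0 ≤ k := by positivity
  have hk'0 : 0 ≤ k' := by positivity
  have hc0 : 0 ≤ c := by positivity
  have hxs' : V ∈ 𝓝 x := hG.mem_nhds hx
  have hKd : DifferentiableAt ℝ K x := ((hK x hx).contDiffAt hxs').differentiableAt (by simp)
  have hXd : DifferentiableAt ℝ X x := ((hX x hx).contDiffAt hxs').differentiableAt (by simp)
  have formula := hG.fderiv_fderiv_lapse_apply b hx hn hKd hKs hXd (hkid x hx).2 (hkid x hx).1
    (hcv x hx).1 ((hcv x hx).2 (X x))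
  set S : ℝ := a + k + k' + c with hS
  have haS : a ≤ S := by rw [hS]; linarith
  have hkS : k ≤ S := by rw [hS]; linarith
  have hk'S : k' ≤ S := by rw [hS]; linarith
  have hcS : c ≤ S := by rw [hS]; linarith
  have hM0 : 0 ≤ S * (‖N x‖ + ‖fderiv ℝ N x‖ + ‖X x‖ + ‖fderiv ℝ X x‖) := by positivity
  refine ContinuousLinearMap.opNorm_le_bound _ hM0 fun Y ↦ ?_
  refine ContinuousLinearMap.opNorm_le_bound _ (by positivity) fun Z ↦ ?_
  have hYZ : 0 ≤ ‖Y‖ * ‖Z‖ := by positivity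
  rw [formula Y Z]
  have hP' : (ricAt G x + (mtrAt G x (K x)) • K x
      - (2 : ℝ) • (K x).comp ((sharpAt G x).comp (K x))) Y Z = P x Y Z := by rw [hP]
  rw [hP']
  -- term by term
  have t1 : ‖N x * P x Y Z‖ ≤ a * ‖N x‖ * (‖Y‖ * ‖Z‖) := by
    rw [norm_mul]
    calc ‖N x‖ * ‖P x Y Z‖ ≤ ‖N x‖ * (‖P x‖ * ‖Y‖ * ‖Z‖) := by
          gcongr; exact (P x).le_opNorm₂ Y Z
      _ ≤ ‖N x‖ * (a * ‖Y‖ * ‖Z‖) := by gcongr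
      _ = a * ‖N x‖ * (‖Y‖ * ‖Z‖) := by ring
  have t2 : ‖fderiv ℝ K x (X x) Y Z‖ ≤ k' * ‖X x‖ * (‖Y‖ * ‖Z‖) := by
    calc ‖fderiv ℝ K x (X x) Y Z‖ ≤ ‖fderiv ℝ K x (X x)‖ * ‖Y‖ * ‖Z‖ :=
          (fderiv ℝ K x (X x)).le_opNorm₂ Y Z
      _ ≤ ‖fderiv ℝ K x‖ * ‖X x‖ * ‖Y‖ * ‖Z‖ := by
          gcongr; exact (fderiv ℝ K x).le_opNorm _
      _ ≤ k' * ‖X x‖ * ‖Y‖ * ‖Z‖ := by gcongr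
      _ = k' * ‖X x‖ * (‖Y‖ * ‖Z‖) := by ring
  have t3 : ‖K x (fderiv ℝ X x Y) Z‖ ≤ k * ‖fderiv ℝ X x‖ * (‖Y‖ * ‖Z‖) := by
    calc ‖K x (fderiv ℝ X x Y) Z‖ ≤ ‖K x‖ * ‖fderiv ℝ X x Y‖ * ‖Z‖ := (K x).le_opNorm₂ _ Z
      _ ≤ ‖K x‖ * (‖fderiv ℝ X x‖ * ‖Y‖) * ‖Z‖ := by
          gcongr; exact (fderiv ℝ X x).le_opNorm _
      _ ≤ k * (‖fderiv ℝ X x‖ * ‖Y‖) * ‖Z‖ := by gcongr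
      _ = k * ‖fderiv ℝ X x‖ * (‖Y‖ * ‖Z‖) := by ring
  have t4 : ‖K x Y (fderiv ℝ X x Z)‖ ≤ k * ‖fderiv ℝ X x‖ * (‖Y‖ * ‖Z‖) := by
    calc ‖K x Y (fderiv ℝ X x Z)‖ ≤ ‖K x‖ * ‖Y‖ * ‖fderiv ℝ X x Z‖ := (K x).le_opNorm₂ Y _
      _ ≤ ‖K x‖ * ‖Y‖ * (‖fderiv ℝ X x‖ * ‖Z‖) := by
          gcongr; exact (fderiv ℝ X x).le_opNorm _
      _ ≤ k * ‖Y‖ * (‖fderiv ℝ X x‖ * ‖Z‖) := by gcongr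
      _ = k * ‖fderiv ℝ X x‖ * (‖Y‖ * ‖Z‖) := by ring
  have t5 : ‖fderiv ℝ N x (chrAt G x Y Z)‖ ≤ c * ‖fderiv ℝ N x‖ * (‖Y‖ * ‖Z‖) := by
    calc ‖fderiv ℝ N x (chrAt G x Y Z)‖ ≤ ‖fderiv ℝ N x‖ * ‖chrAt G x Y Z‖ :=
          (fderiv ℝ N x).le_opNorm _
      _ ≤ ‖fderiv ℝ N x‖ * (‖chrAt G x‖ * ‖Y‖ * ‖Z‖) := by
          gcongr; exact (chrAt G x).le_opNorm₂ Y Z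
      _ ≤ ‖fderiv ℝ N x‖ * (c * ‖Y‖ * ‖Z‖) := by gcongr
      _ = c * ‖fderiv ℝ N x‖ * (‖Y‖ * ‖Z‖) := by ring
  have t234 : ‖2⁻¹ * (fderiv ℝ K x (X x) Y Z + K x (fderiv ℝ X x Y) Z + K x Y (fderiv ℝ X x Z))‖ ≤
      k' * ‖X x‖ * (‖Y‖ * ‖Z‖) + k * ‖fderiv ℝ X x‖ * (‖Y‖ * ‖Z‖) := by
    rw [norm_mul, Real.norm_of_nonneg (by norm_num : (0 : ℝ) ≤ 2⁻¹)]
    have h := (norm_add_le _ _).trans (add_le_add ((norm_add_le _ _).trans (add_le_add t2 t3)) t4)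
    have h0 : 0 ≤ k' * ‖X x‖ * (‖Y‖ * ‖Z‖) := by positivity
    nlinarith [h, h0, norm_nonneg (fderiv ℝ K x (X x) Y Z + K x (fderiv ℝ X x Y) Z
      + K x Y (fderiv ℝ X x Z))]
  calc ‖N x * P x Y Z
        - 2⁻¹ * (fderiv ℝ K x (X x) Y Z + K x (fderiv ℝ X x Y) Z + K x Y (fderiv ℝ X x Z))
        + fderiv ℝ N x (chrAt G x Y Z)‖
      ≤ a * ‖N x‖ * (‖Y‖ * ‖Z‖) + (k' * ‖X x‖ * (‖Y‖ * ‖Z‖) + k * ‖fderiv ℝ X x‖ * (‖Y‖ * ‖Z‖))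
        + c * ‖fderiv ℝ N x‖ * (‖Y‖ * ‖Z‖) :=
        (norm_add_le _ _).trans (add_le_add ((norm_sub_le _ _).trans (add_le_add t1 t234)) t5)
    _ ≤ S * ‖N x‖ * (‖Y‖ * ‖Z‖) + (S * ‖X x‖ * (‖Y‖ * ‖Z‖) + S * ‖fderiv ℝ X x‖ * (‖Y‖ * ‖Z‖))
        + S * ‖fderiv ℝ N x‖ * (‖Y‖ * ‖Z‖) := by gcongr
    _ = S * (‖N x‖ + ‖fderiv ℝ N x‖ + ‖X x‖ + ‖fderiv ℝ X x‖) * ‖Y‖ * ‖Z‖ := by ring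

/-- **Prolongation bound for the shift.** For a smooth KID `(N, X)` of smooth data `(G, K)` on `V`
(dimension `≠ 1`), near every point of `V` `‖D²X_x‖ ≤ C (|N x| + ‖DN_x‖ + ‖X x‖ + ‖DX_x‖)`: the
first KID equation is the Killing equation with source `S = −4N K`
(`IsMetricOn.lieFormAt_metric_eq_of_kidK`), to which `KIDJetRigidity.exists_norm_fderiv_fderiv_le`
applies, and `‖DS‖ ≤ 4 (‖DN‖ ‖K‖ + |N| ‖DK‖)`. Beig–Chruściel 1997, §2. [cite: BeigChrusciel1997, §2] -/
theorem IsMetricOn.exists_norm_fderiv_fderiv_shift_le (hG : IsMetricOn G V) (hn : finrank ℝ E ≠ 1)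
    (hK : ContDiffOn ℝ ∞ K V) (hN : ContDiffOn ℝ ∞ N V) (hX : ContDiffOn ℝ ∞ X V)
    (hkid : ∀ y ∈ V, adjHamK G K N y + adjMomKS G X y = 0) {x₀ : E} (hx₀ : x₀ ∈ V) :
    ∃ C : ℝ, ∀ᶠ x in 𝓝 x₀, ‖fderiv ℝ (fderiv ℝ X) x‖ ≤
      C * (‖N x‖ + ‖fderiv ℝ N x‖ + ‖X x‖ + ‖fderiv ℝ X x‖) := by
  have hxs : V ∈ 𝓝 x₀ := hG.mem_nhds hx₀
  set S : E → E →L[ℝ] E →L[ℝ] ℝ := fun y ↦ -(4 * N y) • K y with hS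
  have hNd : DifferentiableOn ℝ N V := hN.differentiableOn (by simp)
  have hKd : DifferentiableOn ℝ K V := hK.differentiableOn (by simp)
  have hSd : DifferentiableOn ℝ S V := ((hNd.const_mul (4 : ℝ)).neg).smul hKd
  have hKill : ∀ y ∈ V, ∀ u w,
      fderiv ℝ G y (X y) u w + G y (fderiv ℝ X y u) w + G y u (fderiv ℝ X y w) = S y u w := by
    intro y hy u w
    have h := hG.lieFormAt_metric_eq_of_kidK hy hn (hkid y hy)
    have huw := congrArg (fun B : E →L[ℝ] E →L[ℝ] ℝ ↦ B u w) h
    simpa only [lieFormAt_apply] using huw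
  have hnd : ∀ u, (∀ w, G x₀ u w = 0) → u = 0 := by
    intro u hu
    have hi := hG.isInvertible x₀ hx₀
    have h0 : G x₀ u = 0 := ContinuousLinearMap.ext fun w ↦ by rw [hu w]; rfl
    have := congrArg (sharpAt G x₀) h0
    rwa [sharpAt_apply hi, map_zero] at this
  obtain ⟨C, hC⟩ := KIDJetRigidity.exists_norm_fderiv_fderiv_le hG.isOpen
    (hG.contDiffOn.of_le (by norm_cast)) (hX.of_le (by norm_cast)) hSd hG.symm hKill hx₀ hnd
  -- `‖DS‖ ≤ 4 (‖DN‖ ‖K‖ + |N| ‖DK‖)`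
  have hK1 : ContDiffOn ℝ ∞ (fderiv ℝ K) V := hK.fderiv_of_isOpen hG.isOpen (by simp)
  have hKc : ContinuousAt K x₀ := (hK.continuousOn.continuousWithinAt hx₀).continuousAt hxs
  have hK'c : ContinuousAt (fderiv ℝ K) x₀ :=
    (hK1.continuousOn.continuousWithinAt hx₀).continuousAt hxs
  set k : ℝ := ‖K x₀‖ + 1 with hk
  set k' : ℝ := ‖fderiv ℝ K x₀‖ + 1 with hk'
  refine ⟨max C 0 * (1 + 4 * (k + k')), ?_⟩
  filter_upwards [hC, eventually_norm_le hKc, eventually_norm_le hK'c, hG.eventually_mem hx₀]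
    with x hCx hKx hK'x hx
  have hk0 : 0 ≤ k := by positivity
  have hk'0 : 0 ≤ k' := by positivity
  have hxs' : V ∈ 𝓝 x := hG.mem_nhds hx
  have hNx : DifferentiableAt ℝ N x := hNd.differentiableAt hxs'
  have hKx' : DifferentiableAt ℝ K x := hKd.differentiableAt hxs'
  -- the derivative of the source
  have hSder : HasFDerivAt S ((-(4 * N x)) • fderiv ℝ K x
      + (-((4 : ℝ) • fderiv ℝ N x)).smulRight (K x)) x :=
    (hNx.hasFDerivAt.const_mul (4 : ℝ)).neg.smul hKx'.hasFDerivAt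
  have hSn : ‖fderiv ℝ S x‖ ≤ 4 * (k + k') * (‖N x‖ + ‖fderiv ℝ N x‖) := by
    rw [hSder.fderiv]
    refine (norm_add_le _ _).trans ?_
    have e1 : ‖(-(4 * N x)) • fderiv ℝ K x‖ ≤ 4 * ‖N x‖ * k' := by
      rw [norm_smul, norm_neg, norm_mul, Real.norm_of_nonneg (by norm_num : (0 : ℝ) ≤ 4)]
      gcongr
    have e2 : ‖(-((4 : ℝ) • fderiv ℝ N x)).smulRight (K x)‖ ≤ 4 * ‖fderiv ℝ N x‖ * k := by
      rw [ContinuousLinearMap.norm_smulRight_apply, norm_neg, norm_smul, Real.norm_of_nonneg (by norm_num : (0 : ℝ) ≤ 4)]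
      gcongr
    nlinarith [e1, e2, norm_nonneg (N x), norm_nonneg (fderiv ℝ N x)]
  set M : ℝ := ‖N x‖ + ‖fderiv ℝ N x‖ + ‖X x‖ + ‖fderiv ℝ X x‖ with hM
  have hM0 : 0 ≤ M := by positivity
  have h1 : ‖X x‖ + ‖fderiv ℝ X x‖ + ‖fderiv ℝ S x‖ ≤ (1 + 4 * (k + k')) * M := by
    rw [hM]
    nlinarith [hSn, norm_nonneg (N x), norm_nonneg (fderiv ℝ N x), norm_nonneg (X x),
      norm_nonneg (fderiv ℝ X x)]
  calc ‖fderiv ℝ (fderiv ℝ X) x‖ ≤ C * (‖X x‖ + ‖fderiv ℝ X x‖ + ‖fderiv ℝ S x‖) := hCx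
    _ ≤ max C 0 * (‖X x‖ + ‖fderiv ℝ X x‖ + ‖fderiv ℝ S x‖) :=
        mul_le_mul_of_nonneg_right (le_max_left _ _) (by positivity)
    _ ≤ max C 0 * ((1 + 4 * (k + k')) * M) := mul_le_mul_of_nonneg_left h1 (le_max_right _ _)
    _ = max C 0 * (1 + 4 * (k + k')) * M := by ring

/-! ### One-jet rigidity of Killing initial data -/

/-- **Killing initial data are determined by their one-jet at a point.** Let `G` be metric
components on the preconnected open set `V` (dimension `≠ 1`), `K` a smooth symmetric field with
`H = 0`, `M = 0` on `V`, and `(N, X)` a smooth KID (`DH*_γ N + DM*ˢ_γ X = 0`, `DH*_κ N + DM*ˢ_κ X = 0`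
on `V`). If `N x₀ = 0`, `DN_{x₀} = 0`, `X x₀ = 0`, `DX_{x₀} = 0` at one point `x₀ ∈ V`, then
`N = 0` and `X = 0` on `V`: the one-jet `u = (N, DN, X, DX)` satisfies `‖Du‖ ≤ C ‖u‖` locally
(`exists_norm_fderiv_fderiv_lapse_le`, `exists_norm_fderiv_fderiv_shift_le`), so Grönwall propagation
(`KIDJetRigidity.eqOn_zero_of_isPreconnected_of_norm_fderiv_le`) applies. Moncrief 1975, §III
(through the Killing development); Beig–Chruściel 1997, §2 (directly on the data, as here).
[cite: Moncrief1975, §III] -/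
theorem IsMetricOn.kid_eq_zero_of_oneJet_eq_zero (hG : IsMetricOn G V) (hVc : IsPreconnected V)
    (hn : finrank ℝ E ≠ 1) (hK : ContDiffOn ℝ ∞ K V) (hKs : ∀ y ∈ V, ∀ v w, K y v w = K y w v)
    (hcv : ∀ y ∈ V, hamAt G K y = 0 ∧ ∀ Z : E, momFn b G K y Z = 0)
    (hN : ContDiffOn ℝ ∞ N V) (hX : ContDiffOn ℝ ∞ X V)
    (hkid : ∀ y ∈ V, adjHamG G K N y + adjMomGS G K X y = 0 ∧ adjHamK G K N y + adjMomKS G X y = 0)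
    {x₀ : E} (hx₀ : x₀ ∈ V) (h₁ : N x₀ = 0) (h₂ : fderiv ℝ N x₀ = 0) (h₃ : X x₀ = 0)
    (h₄ : fderiv ℝ X x₀ = 0) : ∀ y ∈ V, N y = 0 ∧ X y = 0 := by
  -- the one-jet as a map into a normed space
  let u : E → ℝ × (E →L[ℝ] ℝ) × E × (E →L[ℝ] E) :=
    fun y ↦ (N y, fderiv ℝ N y, X y, fderiv ℝ X y)
  have hN1 : ContDiffOn ℝ ∞ (fderiv ℝ N) V := hN.fderiv_of_isOpen hG.isOpen (by simp)
  have hX1 : ContDiffOn ℝ ∞ (fderiv ℝ X) V := hX.fderiv_of_isOpen hG.isOpen (by simp)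
  have hderiv : ∀ y ∈ V, HasFDerivAt u
      ((fderiv ℝ N y).prod ((fderiv ℝ (fderiv ℝ N) y).prod
        ((fderiv ℝ X y).prod (fderiv ℝ (fderiv ℝ X) y)))) y := by
    intro y hy
    have hys : V ∈ 𝓝 y := hG.mem_nhds hy
    have d0 : DifferentiableAt ℝ N y := ((hN y hy).contDiffAt hys).differentiableAt (by simp)
    have d1 : DifferentiableAt ℝ (fderiv ℝ N) y :=
      ((hN1 y hy).contDiffAt hys).differentiableAt (by simp)
    have d2 : DifferentiableAt ℝ X y := ((hX y hy).contDiffAt hys).differentiableAt (by simp)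
    have d3 : DifferentiableAt ℝ (fderiv ℝ X) y :=
      ((hX1 y hy).contDiffAt hys).differentiableAt (by simp)
    exact d0.hasFDerivAt.prodMk (d1.hasFDerivAt.prodMk (d2.hasFDerivAt.prodMk d3.hasFDerivAt))
  have hu : DifferentiableOn ℝ u V := fun y hy ↦ (hderiv y hy).differentiableAt.differentiableWithinAt
  have hb : ∀ x₁ ∈ V, ∃ C : ℝ, ∀ᶠ y in 𝓝 x₁, ‖fderiv ℝ u y‖ ≤ C * ‖u y‖ := by
    intro x₁ hx₁
    obtain ⟨C₁, hC₁⟩ := hG.exists_norm_fderiv_fderiv_lapse_le b hn hK hKs hcv hX hkid hx₁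
    obtain ⟨C₂, hC₂⟩ := hG.exists_norm_fderiv_fderiv_shift_le hn hK hN hX (fun y hy ↦ (hkid y hy).2) hx₁
    refine ⟨4 * (1 + max C₁ 0 + max C₂ 0), ?_⟩
    filter_upwards [hC₁, hC₂, hG.eventually_mem hx₁] with y h1y h2y hy
    rw [(hderiv y hy).fderiv]
    set M : ℝ := ‖N y‖ + ‖fderiv ℝ N y‖ + ‖X y‖ + ‖fderiv ℝ X y‖ with hM
    -- `M ≤ 4 ‖u y‖`
    have n1 : ‖N y‖ ≤ ‖u y‖ := _root_.norm_fst_le (u y)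
    have n2 : ‖fderiv ℝ N y‖ ≤ ‖u y‖ := (_root_.norm_fst_le (u y).2).trans (_root_.norm_snd_le (u y))
    have n3 : ‖X y‖ ≤ ‖u y‖ :=
      ((_root_.norm_fst_le (u y).2.2).trans (_root_.norm_snd_le (u y).2)).trans
        (_root_.norm_snd_le (u y))
    have n4 : ‖fderiv ℝ X y‖ ≤ ‖u y‖ :=
      ((_root_.norm_snd_le (u y).2.2).trans (_root_.norm_snd_le (u y).2)).trans
        (_root_.norm_snd_le (u y))
    have hMu : M ≤ 4 * ‖u y‖ := by rw [hM]; linarith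
    have hM0 : 0 ≤ M := by positivity
    set L : ℝ := 1 + max C₁ 0 + max C₂ 0 with hL
    have hL1 : 1 ≤ L := by rw [hL]; linarith [le_max_right C₁ 0, le_max_right C₂ 0]
    have hL0 : 0 ≤ L := zero_le_one.trans hL1
    have hC₁L : max C₁ 0 ≤ L := by rw [hL]; linarith [le_max_right C₂ 0]
    have hC₂L : max C₂ 0 ≤ L := by rw [hL]; linarith [le_max_right C₁ 0]
    have m1 : ‖fderiv ℝ N y‖ ≤ M := by
      rw [hM]; linarith [norm_nonneg (N y), norm_nonneg (X y), norm_nonneg (fderiv ℝ X y)]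
    have m3 : ‖fderiv ℝ X y‖ ≤ M := by
      rw [hM]; linarith [norm_nonneg (N y), norm_nonneg (X y), norm_nonneg (fderiv ℝ N y)]
    have b1 : ‖fderiv ℝ N y‖ ≤ L * M := m1.trans (le_mul_of_one_le_left hM0 hL1)
    have b2 : ‖fderiv ℝ (fderiv ℝ N) y‖ ≤ L * M :=
      (h1y.trans (mul_le_mul_of_nonneg_right (le_max_left _ _) hM0)).trans
        (mul_le_mul_of_nonneg_right hC₁L hM0)
    have b3 : ‖fderiv ℝ X y‖ ≤ L * M := m3.trans (le_mul_of_one_le_left hM0 hL1)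
    have b4 : ‖fderiv ℝ (fderiv ℝ X) y‖ ≤ L * M :=
      (h2y.trans (mul_le_mul_of_nonneg_right (le_max_left _ _) hM0)).trans
        (mul_le_mul_of_nonneg_right hC₂L hM0)
    calc ‖(fderiv ℝ N y).prod ((fderiv ℝ (fderiv ℝ N) y).prod
            ((fderiv ℝ X y).prod (fderiv ℝ (fderiv ℝ X) y)))‖ ≤ L * M := by
          simp only [ContinuousLinearMap.opNorm_prod, Prod.norm_def]
          exact max_le b1 (max_le b2 (max_le b3 b4))
      _ ≤ L * (4 * ‖u y‖) := mul_le_mul_of_nonneg_left hMu hL0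
      _ = 4 * (1 + max C₁ 0 + max C₂ 0) * ‖u y‖ := by rw [hL]; ring
  have h0 : u x₀ = 0 := by simp [u, h₁, h₂, h₃, h₄]
  have hzero := KIDJetRigidity.eqOn_zero_of_isPreconnected_of_norm_fderiv_le hG.isOpen hVc hu hb hx₀ h0
  intro y hy
  have h := hzero y hy
  simp only [u, Prod.mk_eq_zero] at h
  exact ⟨h.1, h.2.2.1⟩

end MetricCoord

end Literature.Geometry.Lorentzian

end
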